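import Summits.AnomalousDissipation.AnomalousDissipation.Theorems.QuarticTightness.Negative.Anatomy
import Summits.AnomalousDissipation.AnomalousDissipation.Theorems.QuarticTightness.Negative.CubicCertificateBarrier

/-!
# Route MomentParity / QuarticLadder · crux `QuarticTightness` (stmt-AnomalousDissipation-14331), line `horizon-shooting`:
# the NORMALISED restatements of the crux (refuter flag F3), their drop-in glue, and their certified kill classes

Support file of the line lead (continuation c14) — the typed HANDBACK that goes with `promote-stub`. The line's only
open stub S6\* `stub_gateHorizonLoud` is kernel-certified equivalent to the crux
(`stub_quarticTightnessIffGateHorizonLoud`, p143187), so the skeleton cannot be reshaped below crux size; what the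
tenure planner needs instead (STRATEGY-CENSUS v3 §S8/§D7/§N(f), recommendation 2; lead c13 recommendation (i)) is the
F3-NORMALISED form of binders 1–2 of route QuarticLadder, with its logical position and its kill path certified.
Everything is stated INLINE in the existing vocabulary (`IsQuarticWitness`, `LadderConcl`, `dissDensity`, `polyGrad`,
`IsBandTest`, `IsLevel`); no definition is introduced. Writing

* `GateHyp⁶ f ν E ε M` := `∀ j ∃ᶠ N ∃ μ, IsQuarticWitness f (ν j) N E ε μ ∧ ∫‖u‖⁶dμ ≤ M` (sixth moments bounded
  UNIFORMLY in `j` and `N` — the refuter's flag F3; it excludes the far-atom designs of crux 11464's lines, whose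
  atoms of weight `≍ r⁻⁴` at radius `r → ∞` have sixth moment `≍ r²`),
* `GateHypᴿ f ν E ε R` := `∀ j ∃ᶠ N ∃ μ, IsQuarticWitness f (ν j) N E ε μ ∧ ‖u‖ ≤ R μ-a.s.` (ONE support radius
  before `∀ j`),
* `QT⁶` / `QTᴿ` := the crux with `GateHyp` replaced by `GateHyp⁶` / `GateHypᴿ` (all `M`, resp. all `R`), and
  `QuarticGate⁶` := `∃ f ν E ε M, … ∧ GateHyp⁶ f ν E ε M`,

the file proves (sorry-free; each theorem a registered calibration stub of the skeleton `Lines/Ideate3Sketch.lean` v3.2):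

* POSITION. `stub_quarticTightness6_of_quarticTightness : QT → QT⁶` and
  `stub_quarticTightnessR_of_quarticTightness6 : QT⁶ → QTᴿ` — both restatements are WEAKENINGS of the crux (so a
  counterexample to either refutes the crux, and a proof of the crux proves both); `quarticGate_of_normalisedGate :
  QuarticGate⁶ → QuarticGate`. Under either normalisation the conclusion no longer implies the hypothesis (the ladder's
  radius `R_j ∼ ‖f‖₂/(4π²ν_j)` is `j`-dependent), so Anatomy's "equivalence of badges" becomes one-directional: the
  restated crux keeps exactly the climbing content "bounded loud order-4 statistics ⇒ loud invariant laws".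
* DROP-IN GLUE. `stub_ladderGlue2_normalised : QuarticGate⁶ → QT⁶ → UniformResolution → MomentLadder` — the pair
  (QuarticGate⁶, QT⁶) replaces binders 1–2 on the deciding path `closes` of QuarticLadder verbatim (pure logic, as
  `ladderGlue2_proof`).
* KILL CLASSES (weak duality). `stub_sexticCertificateKill`: a CUBIC auxiliary functional `p` (band tests, `deg P ≤ 3`)
  with multipliers `λ, τ ≥ 0` and the pointwise inequality on level-`N` fields
  `ν‖∇u‖² + ⟨F(u), ∇p(u)⟩ + λ(E − ‖u‖²) + τ(M − ‖u‖⁶) ≤ U` forces `ε ≤ U` for every `GateHyp⁶`-witness (integrate: the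
  row of `p` vanishes by 4-stationarity, both multiplier terms are signed by the budgets);
  `stub_notGateHyp6_of_sexticCertificates`: such certificates of value `< ε'` for every target, at some `j`,
  eventually in `N`, kill `GateHyp⁶` — the SDP degree sweep of TRIAGE-r1-2/3 made a theorem schema;
  `stub_ballCertificateKill`: for `GateHypᴿ`-witnesses the inequality is needed only ON THE BALL `‖u‖ ≤ R` (any
  Positivstellensatz multiplier). Degree bookkeeping (why this is a kill path for QT⁶/QTᴿ and not for QT, cf. the landed
  `not_gateHyp_of_cubicCertificates`): with `τ > 0` the left side tends to `−∞` like `−τ‖u‖⁶` at infinity on the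
  finite-dimensional level space (the row `⟨F(u), ∇p(u)⟩` has degree `≤ 4`), so the certificate inequality bites only
  on a compact set and is decidable by SOS at each `(N, ν)`; at `τ = 0` the quartic top `⟨B(u,u), ∇p₃(u)⟩` must be
  signed in every direction, i.e. the cubic top of `p` must be an Euler Casimir of the truncation (census N(f),
  TRIAGE-r1-2 `eulerDeriv_energySq_eq_zero`), which is why no cubic certificate coexists with the plain gate.

What is NOT claimed: that QT⁶ is provable (on every physically loud force the true invariant laws pass the normalised
gate, so QT⁶ is still floor-grade there — census S8), nor that `GateHyp⁶` holds at any force (that is the restated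
binder 1, `QuarticGate⁶`: loud order-4 statistics with bounded sixth moments, open). Sources: FMRT 2001 Ch. IV App. B;
Tobasco–Goluskin–Doering, Phys. Lett. A 382 (2018) §5–6 (auxiliary functionals, weak duality); Fantuzzi–Goluskin–
Huang–Chernyshenko, SIAM J. Appl. Dyn. Syst. 15 (2016) (SOS bounds for polynomial ODEs); Lasserre 2001 / Putinar 1993
(Positivstellensatz on compacta). Nothing here proves a Theses decl.
-/

noncomputable section

-- `Summit.<Summit>.<Problem>` is the tree's mandated summit-side namespace (CONVENTIONS §2); for this
-- single-conjunct summit the two coincide, so the duplicate is deliberate.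
set_option linter.dupNamespace false

namespace Summit.AnomalousDissipation.AnomalousDissipation.Theorems.MomentParityQuarticTightness

open MeasureTheory Filter Topology Set Function
open scoped ENNReal InnerProductSpace RealInnerProductSpace
open Literature.Analysis.FunctionSpaces Literature.Analysis.FunctionSpaces.Torus
open Literature.Analysis.FluidPDE Literature.Analysis.FluidPDE.Torus
open Summit.AnomalousDissipation.AnomalousDissipation.Theses.MomentParity
open Summit.AnomalousDissipation.AnomalousDissipation.Theorems
open Summit.AnomalousDissipation.AnomalousDissipation.Theorems.QuarticGate.Negative
open Summit.AnomalousDissipation.AnomalousDissipation.Theorems.QuarticTightness.Negative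

-- `T3 = T³`, `R3 = ℝ³`, `H3 = H`, `L2T3 = L²(T³; ℝ³)` (sibling crux's abbreviations).
open Summit.AnomalousDissipation.AnomalousDissipation.Theorems.CubicParityLoud.Negative (T3 R3 H3 L2T3)

/-! ## A. Position: QT ⇒ QT⁶ ⇒ QTᴿ, QuarticGate⁶ ⇒ QuarticGate -/

/-- **S17 — the sixth-moment–normalised crux QT⁶ is a WEAKENING of `QuarticTightness`.** If the crux holds, then so does
its restatement whose gate hypothesis asks in addition for sixth moments bounded by one `M` uniformly in `j` and `N`
(drop the extra clauses and apply the crux). Registered calibration stub of the line's skeleton v3.2. [folklore] -/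
theorem stub_quarticTightness6_of_quarticTightness :
    QuarticTightness →
    ∀ f : T3 → R3, Torus.IsSmooth f → Torus.IsDivFree f → Torus.HasZeroMean f →
      ∀ (ν : ℕ → ℝ) (E ε M : ℝ), (∀ j, 0 < ν j) → Tendsto ν atTop (𝓝 0) → 0 < ε →
      (∀ j : ℕ, ∃ᶠ N in atTop, ∃ μ : Measure H3,
        IsQuarticWitness f (ν j) N E ε μ ∧ Integrable (fun u : H3 => ‖u‖ ^ 6) μ ∧ ∫ u, ‖u‖ ^ 6 ∂μ ≤ M) →
      ∃ E' ε' : ℝ, 0 < ε' ∧ LadderConcl f ν E' ε' := by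
  intro h f hfs hfd hfz ν E ε M hν hν0 hε hH
  exact quarticTightness_iff.1 h f hfs hfd hfz ν E ε hν hν0 hε
    fun j => (hH j).mono fun N ⟨μ, hμ, _, _⟩ => ⟨μ, hμ⟩

/-- **S18 — the radius-normalised crux QTᴿ is weaker still: QT⁶ ⇒ QTᴿ.** A gate witness supported in `‖u‖ ≤ R` has
`∫‖u‖⁶dμ ≤ max(R,0)⁶`, so one support radius before `∀ j` gives one sixth-moment bound before `∀ j`. Hence
`QT ⇒ QT⁶ ⇒ QTᴿ`: a counterexample to QTᴿ (bounded designs + a ball certificate, `stub_ballCertificateKill`) refutes the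
crux itself. Registered calibration stub of the line's skeleton v3.2. [folklore] -/
theorem stub_quarticTightnessR_of_quarticTightness6 :
    (∀ f : T3 → R3, Torus.IsSmooth f → Torus.IsDivFree f → Torus.HasZeroMean f →
      ∀ (ν : ℕ → ℝ) (E ε M : ℝ), (∀ j, 0 < ν j) → Tendsto ν atTop (𝓝 0) → 0 < ε →
      (∀ j : ℕ, ∃ᶠ N in atTop, ∃ μ : Measure H3,
        IsQuarticWitness f (ν j) N E ε μ ∧ Integrable (fun u : H3 => ‖u‖ ^ 6) μ ∧ ∫ u, ‖u‖ ^ 6 ∂μ ≤ M) →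
      ∃ E' ε' : ℝ, 0 < ε' ∧ LadderConcl f ν E' ε') →
    ∀ f : T3 → R3, Torus.IsSmooth f → Torus.IsDivFree f → Torus.HasZeroMean f →
      ∀ (ν : ℕ → ℝ) (E ε R : ℝ), (∀ j, 0 < ν j) → Tendsto ν atTop (𝓝 0) → 0 < ε →
      (∀ j : ℕ, ∃ᶠ N in atTop, ∃ μ : Measure H3,
        IsQuarticWitness f (ν j) N E ε μ ∧ ∀ᵐ u ∂μ, ‖u‖ ≤ R) →
      ∃ E' ε' : ℝ, 0 < ε' ∧ LadderConcl f ν E' ε' := by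
  intro h f hfs hfd hfz ν E ε R hν hν0 hε hH
  refine h f hfs hfd hfz ν E ε (max R 0 ^ 6) hν hν0 hε fun j => (hH j).mono ?_
  rintro N ⟨μ, hμ, hb⟩
  haveI : IsProbabilityMeasure μ := hμ.1
  have h6 : Integrable (fun u : H3 => ‖u‖ ^ 6) μ := integrable_norm_pow_of_ae_le hb 6
  refine ⟨μ, hμ, h6, ?_⟩
  calc ∫ u, ‖u‖ ^ 6 ∂μ ≤ ∫ _u, max R 0 ^ 6 ∂μ :=
        integral_mono_ae h6 (integrable_const _)
          (hb.mono fun u hu => pow_le_pow_left₀ (norm_nonneg _) (hu.trans (le_max_left _ _)) 6)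
    _ = max R 0 ^ 6 := by simp

/-- **The normalised ∃-force gate implies `QuarticGate`** (drop the sixth-moment clauses). [folklore] -/
theorem quarticGate_of_normalisedGate
    (hQ : ∃ f : T3 → R3, Torus.IsSmooth f ∧ Torus.IsDivFree f ∧ Torus.HasZeroMean f ∧
      ∃ (ν : ℕ → ℝ) (E ε M : ℝ), (∀ j, 0 < ν j) ∧ Tendsto ν atTop (𝓝 0) ∧ 0 < ε ∧
      ∀ j : ℕ, ∃ᶠ N in atTop, ∃ μ : Measure H3,
        IsQuarticWitness f (ν j) N E ε μ ∧ Integrable (fun u : H3 => ‖u‖ ^ 6) μ ∧ ∫ u, ‖u‖ ^ 6 ∂μ ≤ M) :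
    QuarticGate := by
  obtain ⟨f, hfs, hfd, hfz, ν, E, ε, M, hν, hν0, hε, hj⟩ := hQ
  exact quarticGate_iff.2 ⟨f, hfs, hfd, hfz, ν, E, ε, hν, hν0, hε,
    fun j => (hj j).mono fun N ⟨μ, hμ, _, _⟩ => ⟨μ, hμ⟩⟩

/-! ## B. Drop-in glue: (QuarticGate⁶, QT⁶) replace binders 1–2 of `closes` verbatim -/

/-- **S19 — NORMALISED LADDER GLUE**: `QuarticGate⁶ → QT⁶ → UniformResolution → MomentLadder`, pure logic exactly as
`ladderGlue2_proof` (unpack the force, sequence, budgets and the moment bound from the normalised gate; QT⁶ gives the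
loud ladder with new budgets; `UniformResolution` adds the resolution schedule; repack). So restating binders 1–2 of
route QuarticLadder in the F3-normalised form changes nothing downstream. Registered calibration stub of the line's
skeleton v3.2. [folklore] -/
theorem stub_ladderGlue2_normalised :
    (∃ f : T3 → R3, Torus.IsSmooth f ∧ Torus.IsDivFree f ∧ Torus.HasZeroMean f ∧
      ∃ (ν : ℕ → ℝ) (E ε M : ℝ), (∀ j, 0 < ν j) ∧ Tendsto ν atTop (𝓝 0) ∧ 0 < ε ∧
      ∀ j : ℕ, ∃ᶠ N in atTop, ∃ μ : Measure H3,
        IsQuarticWitness f (ν j) N E ε μ ∧ Integrable (fun u : H3 => ‖u‖ ^ 6) μ ∧ ∫ u, ‖u‖ ^ 6 ∂μ ≤ M) →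
    (∀ f : T3 → R3, Torus.IsSmooth f → Torus.IsDivFree f → Torus.HasZeroMean f →
      ∀ (ν : ℕ → ℝ) (E ε M : ℝ), (∀ j, 0 < ν j) → Tendsto ν atTop (𝓝 0) → 0 < ε →
      (∀ j : ℕ, ∃ᶠ N in atTop, ∃ μ : Measure H3,
        IsQuarticWitness f (ν j) N E ε μ ∧ Integrable (fun u : H3 => ‖u‖ ^ 6) μ ∧ ∫ u, ‖u‖ ^ 6 ∂μ ≤ M) →
      ∃ E' ε' : ℝ, 0 < ε' ∧ LadderConcl f ν E' ε') →
    UniformResolution → MomentLadder := by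
  intro hQ hT hU
  obtain ⟨f, hfs, hfd, hfz, ν, E, ε, M, hν, hν0, hε, hj⟩ := hQ
  obtain ⟨E₁, ε₁, hε₁, h₁⟩ := hT f hfs hfd hfz ν E ε M hν hν0 hε hj
  obtain ⟨E₂, ε₂, hε₂, h₂⟩ := hU f hfs hfd hfz ν E₁ ε₁ hν hν0 hε₁ h₁
  exact ⟨f, hfs, hfd, hfz, ν, E₂, ε₂, hν, hν0, hε₂, h₂⟩

/-! ## C. Kill classes: weak duality with a sextic slack, and on the ball -/

/-- **S20 — SEXTIC-SLACK CERTIFICATES KILL NORMALISED GATE WITNESSES (weak duality).** Let `μ` be a level-`N` gate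
witness at `(f, ν, E, ε)` with `∫‖u‖⁶dμ ≤ M`, and let band tests `g`, a polynomial `P` of total degree `≤ 3`,
multipliers `λ, τ ≥ 0` and a value `U` satisfy, pointwise on level-`N` fields,
`ν‖∇u‖² + ⟨F(u), ∇p(u)⟩ + λ(E − ‖u‖²) + τ(M − ‖u‖⁶) ≤ U`. Then `ε ≤ U`: integrate against `μ` — the row of the cubic
observable `p` vanishes by 4-stationarity, `λ(E − ∫‖u‖²) ≥ 0` by the energy budget and `τ(M − ∫‖u‖⁶) ≥ 0` by the
normalisation. With `τ > 0` the left side is `−τ‖u‖⁶ + O(‖u‖⁴)` at infinity, so such certificates exist as soon as the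
inequality holds on a compact set (SOS-searchable at each `(N, ν)`), unlike the cubic certificates of
`gateWitness_eps_le_of_cubicCertificate` (`τ = 0`). Registered calibration stub of the line's skeleton v3.2. [folklore] -/
theorem stub_sexticCertificateKill :
    ∀ (f : T3 → R3) (ν : ℝ) (N : ℕ) (E ε M U : ℝ) (μ : Measure H3) (m : ℕ) (g : Fin m → T3 → R3)
      (P : MvPolynomial (Fin m) ℝ) (lam tau : ℝ),
      IsQuarticWitness f ν N E ε μ → Integrable (fun u : H3 => ‖u‖ ^ 6) μ → ∫ u, ‖u‖ ^ 6 ∂μ ≤ M →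
      (∀ i, IsBandTest N (g i)) → P.totalDegree + 1 ≤ 4 → 0 ≤ lam → 0 ≤ tau →
      (∀ u : H3, IsLevel N u →
        ν * dissDensity u + Torus.nsGeneratorPairing ν f u (polyGrad g P u) +
          lam * (E - ‖u‖ ^ 2) + tau * (M - ‖u‖ ^ 6) ≤ U) →
      ε ≤ U := by
  intro f ν N E ε M U μ m g P lam tau hw h6 hM hg hP hlam htau hpt
  obtain ⟨hprob, hlev, h4, hstat, hEn, hε⟩ := hw
  have h2 : Integrable (fun u : H3 => ‖u‖ ^ 2) μ := integrable_norm_sq_of_norm_pow_four h4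
  obtain ⟨hGI, hG0⟩ := hstat m g P hg hP
  have hDI : Integrable dissDensity μ := integrable_dissDensity hlev h2
  have hL : Integrable (fun u : H3 => lam * (E - ‖u‖ ^ 2)) μ := ((integrable_const E).sub h2).const_mul lam
  have hT : Integrable (fun u : H3 => tau * (M - ‖u‖ ^ 6)) μ := ((integrable_const M).sub h6).const_mul tau
  have hνD : Integrable (fun u : H3 => ν * dissDensity u) μ := hDI.const_mul ν
  have hS1 : Integrable (fun u : H3 => ν * dissDensity u +
      Torus.nsGeneratorPairing ν f u (polyGrad g P u)) μ := hνD.add hGI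
  have hS2 : Integrable (fun u : H3 => ν * dissDensity u +
      Torus.nsGeneratorPairing ν f u (polyGrad g P u) + lam * (E - ‖u‖ ^ 2)) μ := hS1.add hL
  have hS : Integrable (fun u : H3 => ν * dissDensity u +
      Torus.nsGeneratorPairing ν f u (polyGrad g P u) + lam * (E - ‖u‖ ^ 2) + tau * (M - ‖u‖ ^ 6)) μ :=
    hS2.add hT
  have hint_le : ∫ u, (ν * dissDensity u + Torus.nsGeneratorPairing ν f u (polyGrad g P u) +
      lam * (E - ‖u‖ ^ 2) + tau * (M - ‖u‖ ^ 6)) ∂μ ≤ ∫ _u, U ∂μ :=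
    integral_mono_ae hS (integrable_const U) (hlev.mono fun u hu => hpt u hu)
  have hU : ∫ _u : H3, U ∂μ = U := by simp
  have hsplit : ∫ u, (ν * dissDensity u + Torus.nsGeneratorPairing ν f u (polyGrad g P u) +
      lam * (E - ‖u‖ ^ 2) + tau * (M - ‖u‖ ^ 6)) ∂μ =
        ν * ∫ u, dissDensity u ∂μ + 0 + lam * (E - ∫ u, ‖u‖ ^ 2 ∂μ) + tau * (M - ∫ u, ‖u‖ ^ 6 ∂μ) := by
    rw [integral_add hS2 hT, integral_add hS1 hL, integral_add hνD hGI, integral_const_mul, hG0,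
      integral_const_mul, integral_sub (integrable_const E) h2, integral_const_mul,
      integral_sub (integrable_const M) h6]
    simp
  have hEn' : ∫ u, ‖u‖ ^ 2 ∂μ ≤ E := hEn
  have hdiss := ensembleDissipation_eq_integral_dissDensity (ν := ν) hlev
  have hmul : 0 ≤ lam * (E - ∫ u, ‖u‖ ^ 2 ∂μ) := mul_nonneg hlam (sub_nonneg.2 hEn')
  have hmul6 : 0 ≤ tau * (M - ∫ u, ‖u‖ ^ 6 ∂μ) := mul_nonneg htau (sub_nonneg.2 hM)
  rw [hsplit, hU] at hint_le
  calc ε ≤ Torus.ensembleDissipation ν μ := hε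
    _ = ν * ∫ u, dissDensity u ∂μ := hdiss
    _ ≤ U := by linarith

/-- **S21 — THE KILL PATH OF QT⁶ AS A THEOREM SCHEMA.** If quietness of `f` along `ν` at budgets `(E, M)` is certified
with a sextic slack — for every target `ε' > 0`, at some viscosity index, for all but finitely many levels, a
certificate of `stub_sexticCertificateKill` with value `< ε'` — then the normalised gate hypothesis `GateHyp⁶ f ν E ε M`
fails for every `ε > 0`. Contrast `not_gateHyp_of_cubicCertificates` (no slack): the plain gate admits no such kill.
Registered calibration stub of the line's skeleton v3.2. [folklore] -/
theorem stub_notGateHyp6_of_sexticCertificates :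
    ∀ (f : T3 → R3) (ν : ℕ → ℝ) (E ε M : ℝ), 0 < ε →
      (∀ ε' : ℝ, 0 < ε' → ∃ j : ℕ, ∀ᶠ N in atTop,
        ∃ (U : ℝ) (m : ℕ) (g : Fin m → T3 → R3) (P : MvPolynomial (Fin m) ℝ) (lam tau : ℝ),
          U < ε' ∧ (∀ i, IsBandTest N (g i)) ∧ P.totalDegree + 1 ≤ 4 ∧ 0 ≤ lam ∧ 0 ≤ tau ∧
          ∀ u : H3, IsLevel N u →
            ν j * dissDensity u + Torus.nsGeneratorPairing (ν j) f u (polyGrad g P u) +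
              lam * (E - ‖u‖ ^ 2) + tau * (M - ‖u‖ ^ 6) ≤ U) →
      ¬ ∀ j : ℕ, ∃ᶠ N in atTop, ∃ μ : Measure H3,
        IsQuarticWitness f (ν j) N E ε μ ∧ Integrable (fun u : H3 => ‖u‖ ^ 6) μ ∧ ∫ u, ‖u‖ ^ 6 ∂μ ≤ M := by
  intro f ν E ε M hε hcert hH
  obtain ⟨j, hj⟩ := hcert ε hε
  obtain ⟨N, ⟨μ, hμ, h6, hM⟩, U, m, g, P, lam, tau, hU, hg, hP, hlam, htau, hpt⟩ :=
    ((hH j).and_eventually hj).exists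
  exact absurd (stub_sexticCertificateKill f (ν j) N E ε M U μ m g P lam tau hμ h6 hM hg hP hlam htau hpt)
    (not_le.2 hU)

/-- **S22 — BALL CERTIFICATES KILL RADIUS-NORMALISED GATE WITNESSES (weak duality on the ball).** For a level-`N` gate
witness supported in `‖u‖ ≤ R`, a cubic auxiliary functional with energy multiplier `λ ≥ 0` whose certificate
inequality `ν‖∇u‖² + ⟨F(u), ∇p(u)⟩ + λ(E − ‖u‖²) ≤ U` holds ONLY ON THE BALL `{IsLevel N u, ‖u‖ ≤ R}` already forces
`ε ≤ U` — the inequality is integrated over the carrier only. On the compact ball every Positivstellensatz multiplier is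
available, which is the cheapest falsification programme for QTᴿ (hence, by S17–S18, for the crux) at a force with
BOUNDED designs. Registered calibration stub of the line's skeleton v3.2. [folklore] -/
theorem stub_ballCertificateKill :
    ∀ (f : T3 → R3) (ν : ℝ) (N : ℕ) (E ε R U : ℝ) (μ : Measure H3) (m : ℕ) (g : Fin m → T3 → R3)
      (P : MvPolynomial (Fin m) ℝ) (lam : ℝ),
      IsQuarticWitness f ν N E ε μ → (∀ᵐ u ∂μ, ‖u‖ ≤ R) →
      (∀ i, IsBandTest N (g i)) → P.totalDegree + 1 ≤ 4 → 0 ≤ lam →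
      (∀ u : H3, IsLevel N u → ‖u‖ ≤ R →
        ν * dissDensity u + Torus.nsGeneratorPairing ν f u (polyGrad g P u) + lam * (E - ‖u‖ ^ 2) ≤ U) →
      ε ≤ U := by
  intro f ν N E ε R U μ m g P lam hw hb hg hP hlam hpt
  obtain ⟨hprob, hlev, h4, hstat, hEn, hε⟩ := hw
  have h2 : Integrable (fun u : H3 => ‖u‖ ^ 2) μ := integrable_norm_sq_of_norm_pow_four h4
  obtain ⟨hGI, hG0⟩ := hstat m g P hg hP
  have hDI : Integrable dissDensity μ := integrable_dissDensity hlev h2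
  have hL : Integrable (fun u : H3 => lam * (E - ‖u‖ ^ 2)) μ := ((integrable_const E).sub h2).const_mul lam
  have hνD : Integrable (fun u : H3 => ν * dissDensity u) μ := hDI.const_mul ν
  have hS1 : Integrable (fun u : H3 => ν * dissDensity u +
      Torus.nsGeneratorPairing ν f u (polyGrad g P u)) μ := hνD.add hGI
  have hS : Integrable (fun u : H3 => ν * dissDensity u +
      Torus.nsGeneratorPairing ν f u (polyGrad g P u) + lam * (E - ‖u‖ ^ 2)) μ := hS1.add hL
  have hint_le : ∫ u, (ν * dissDensity u + Torus.nsGeneratorPairing ν f u (polyGrad g P u) +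
      lam * (E - ‖u‖ ^ 2)) ∂μ ≤ ∫ _u, U ∂μ :=
    integral_mono_ae hS (integrable_const U)
      ((hlev.and hb).mono fun u hu => hpt u hu.1 hu.2)
  have hU : ∫ _u : H3, U ∂μ = U := by simp
  have hsplit : ∫ u, (ν * dissDensity u + Torus.nsGeneratorPairing ν f u (polyGrad g P u) +
      lam * (E - ‖u‖ ^ 2)) ∂μ = ν * ∫ u, dissDensity u ∂μ + 0 + lam * (E - ∫ u, ‖u‖ ^ 2 ∂μ) := by
    rw [integral_add hS1 hL, integral_add hνD hGI, integral_const_mul, hG0, integral_const_mul,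
      integral_sub (integrable_const E) h2]
    simp
  have hEn' : ∫ u, ‖u‖ ^ 2 ∂μ ≤ E := hEn
  have hdiss := ensembleDissipation_eq_integral_dissDensity (ν := ν) hlev
  have hmul : 0 ≤ lam * (E - ∫ u, ‖u‖ ^ 2 ∂μ) := mul_nonneg hlam (sub_nonneg.2 hEn')
  rw [hsplit, hU] at hint_le
  calc ε ≤ Torus.ensembleDissipation ν μ := hε
    _ = ν * ∫ u, dissDensity u ∂μ := hdiss
    _ ≤ U := by linarith

end Summit.AnomalousDissipation.AnomalousDissipation.Theorems.MomentParityQuarticTightness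

end
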